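import Summits.ValiantsHypothesis.ValiantsHypothesis.Theses.LacunarySymmetroid
import Summits.ValiantsHypothesis.ValiantsHypothesis.Theorems.LacunarySymmetroidMatrixDescartesCensusDefs
import Summits.ValiantsHypothesis.ValiantsHypothesis.Theorems.LacunarySymmetroidMatrixDescartesStubArith4
import Summits.ValiantsHypothesis.ValiantsHypothesis.Theorems.LacunarySymmetroidMatrixDescartesStubNegRoots

/-!
# Sketch — «tower door» (val-idea-22 g7, crux idea on `MatrixDescartes` = stmt-ValiantsHypothesis-18050)

DOOR SUPPORT FREEDOM.  The route's deciding theorem `LacunarySymmetroid.closes` consumes `MatrixDescartes`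
only on the Kronecker supports of the VNP witness, and those WEIGHTS are free.  Re-weighting the Tavenas /
Hutchinson witness along a hyper-geometric Kronecker curve `y_i ↦ X^{G_n^i}`, `G_n = 2^n`, makes every
transferred pencil support `(0, 1, G_n, …, G_n^{n-1})` an `m`-TOWER (`m·d_l < d_{l'}` for `l < l'`) for every
size `m ≤ 2^{(log n + c)^c} < 2^n = G_n` in the quasi-polynomial window.  Hence the crux is needed only on tower
supports (`TowerMatrixDescartes`), and Conjecture B on towers in the all-real-roots currency
(`TowerRealRootLaw`; = the tree's `TowerB` of LINE (B) `Cruxes/WeakLifting/Lines/tower_graft.lean` up to the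
reflection `X ↦ −X` and the root `0`) already decides the summit together with the CLOSED item `PencilTransfer`
and the new witness item `TowerThetaWitness` (routine variant of the CLOSED `ThetaWitness`).

Kernel content of this file (no `sorry`): the defs, `isTower_cons_pow`, the bridge
`towerMatrixDescartes_of_towerRealRootLaw` (verbatim arithmetic of `Census.matrixDescartes_of_kPlusLogSqLaw`)
and the deciding composition `closes_tower` (verbatim arithmetic of `LacunarySymmetroid.closes` + the tower
discharge).  `TowerThetaWitness` itself is NOT proved here (item-sized, L: the tree's `thetaWitness_proof`
machinery with Gaussian-in-value weights `2^{-2 k²}`; see the card).  VP ≠ VNP is NOT proved by any of this.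
-/

set_option linter.dupNamespace false

open Polynomial
open scoped BigOperators

namespace Summit.ValiantsHypothesis.ValiantsHypothesis.Cruxes.MatrixDescartes.TowerDoor

open Summit.ValiantsHypothesis.ValiantsHypothesis.Theses.LacunarySymmetroid
  (MatrixDescartes PencilTransfer ThetaWitness)
open Summit.ValiantsHypothesis.ValiantsHypothesis.Theorems.LacunarySymmetroidMatrixDescartes

-- `PosRootLawOn` (census currency, positive roots) is `…Theorems.LacunarySymmetroidMatrixDescartes.PosRootLawOn` (CensusDefs).

/-- Tower support relative to the size `m` — VERBATIM the `IsTower` of LINE (B)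
(`Cruxes/WeakLifting/Lines/tower_graft.lean`, namespace `…Cruxes.WeakLifting.TowerGraftLine`), inlined so that this
file does not import a `Cruxes/` module (farm snapshot coherence): every letter exponent exceeds `m` times every
earlier one. -/
def IsTower (m : ℕ) {K : ℕ} (d : Fin K → ℕ) : Prop := ∀ l l' : Fin K, l < l' → m * d l < d l'

/-- VERBATIM the `TowerB` of LINE (B) (same file/namespace; definitionally equal): Conjecture B on tower supports in
the census currency `PosRootLawOn` (positive roots). LINE (B) proves `towerB_of_graftLaw : TowerGraftLaw → TowerB`
(from the registered stub S5 `stub_oneLetterGraftLaw`) and, at rev 9, `towerB_of_sizeDoublingPoly : TowerB` from S4f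
`stub_sizeDoublingPoly` + the CLOSED S4h `stub_sizeMono`. -/
def TowerB : Prop :=
  ∃ C : ℕ, ∀ (m K : ℕ) (d : Fin K → ℕ), IsTower m d → PosRootLawOn m K (2 ^ (C * (K + Nat.log 2 m ^ 2))) d

/-- **D1 — Conjecture B on tower supports, all-real-roots currency** (`TowerB` of LINE (B) up to `X ↦ −X` and the
root `0`): `∃ C, ∀ m K`, every symmetric `(m,K)` pencil on an `m`-tower support has `≤ 2^{C (K + log₂² m)}`
distinct real determinant roots. -/
def TowerRealRootLaw : Prop :=
  ∃ C : ℕ, ∀ (m K : ℕ) (d : Fin K → ℕ) (S : Fin K → Matrix (Fin m) (Fin m) ℝ), IsTower m d →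
    (∀ l, (S l).IsSymm) →
      (Matrix.det (∑ l, ((Polynomial.X : Polynomial ℝ) ^ d l) • (S l).map Polynomial.C)
        ).roots.toFinset.card ≤ 2 ^ (C * (K + Nat.log 2 m ^ 2))

/-- **D2 — the crux `MatrixDescartes` restricted to tower supports** (verbatim, one hypothesis added). -/
def TowerMatrixDescartes : Prop :=
  ∀ c q : ℕ, 0 < q → ∃ K₀ : ℕ, ∀ K m : ℕ, K₀ ≤ K → m ≤ 2 ^ ((Nat.log 2 K + c) ^ c) →
    ∀ (d : Fin K → ℕ) (S : Fin K → Matrix (Fin m) (Fin m) ℝ), IsTower m d → (∀ l, (S l).IsSymm) →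
      (Matrix.det (∑ l, ((Polynomial.X : Polynomial ℝ) ^ d l) • (S l).map Polynomial.C)
        ).roots.toFinset.card ^ q ≤ 2 ^ (K * Nat.log 2 K)

/-- **D3 — the tower-weighted witness**: a VNP family `Θ_n` whose restriction to the hyper-geometric Kronecker
curve `y_i ↦ X^{(2^n)^i}` has `≥ 2^{n ⌊log₂ n⌋} − 1` distinct real roots (eventually in `n`). -/
def TowerThetaWitness : Prop :=
  ∃ Θ : ∀ n : ℕ, MvPolynomial (Fin n) ℝ,
    Literature.Computability.AlgebraicComplexity.IsVNPFamily
        (fun n => MvPolynomial.map (algebraMap ℝ ℂ) (Θ n)) ∧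
      ∃ n₀ : ℕ, ∀ n : ℕ, n₀ ≤ n →
        2 ^ (n * Nat.log 2 n) ≤
          (MvPolynomial.aeval (fun i : Fin n => (Polynomial.X : Polynomial ℝ) ^ (2 ^ n) ^ (i : ℕ))
            (Θ n)).roots.toFinset.card + 1

/-- The transferred support `(0, G^0, G^1, …, G^{n-1})` is an `m`-tower as soon as `m < G`. -/
theorem isTower_cons_pow {m G n : ℕ} (hmG : m < G) :
    IsTower m (Fin.cons (α := fun _ => ℕ) (0 : ℕ) (fun i : Fin n => G ^ (i : ℕ))) := by
  intro l l' hll'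
  have hG1 : 1 ≤ G := by omega
  induction l using Fin.cases with
  | zero =>
    induction l' using Fin.cases with
    | zero => exact absurd hll' (lt_irrefl _)
    | succ j => simp only [Fin.cons_zero, Fin.cons_succ, mul_zero]; exact Nat.one_le_pow _ _ hG1
  | succ i =>
    induction l' using Fin.cases with
    | zero => exact absurd hll' (Fin.not_lt_zero _)
    | succ j =>
      simp only [Fin.cons_succ]
      have hij : (i : ℕ) < j := by
        have := Fin.succ_lt_succ_iff.1 hll'
        exact this
      calc m * G ^ (i : ℕ) < G * G ^ (i : ℕ) := Nat.mul_lt_mul_of_pos_right hmG (Nat.one_le_pow _ _ hG1)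
        _ = G ^ ((i : ℕ) + 1) := (pow_succ' _ _).symm
        _ ≤ G ^ (j : ℕ) := Nat.pow_le_pow_right hG1 hij

/-- The quasi-polynomial window is eventually below `2^n`: `(⌊log₂ n⌋ + c)^c < n` for all large `n`. -/
theorem window_lt (c : ℕ) : ∃ n₁ : ℕ, ∀ n : ℕ, n₁ ≤ n → (Nat.log 2 n + c) ^ c < n := by
  obtain ⟨L₁, hL₁⟩ := StubArith4.poly_le_two_pow c 2
  refine ⟨2 ^ L₁, fun n hn => ?_⟩
  have hn0 : n ≠ 0 := by have := Nat.one_le_two_pow (n := L₁); omega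
  have hL : L₁ ≤ Nat.log 2 n := Nat.le_log_of_pow_le one_lt_two hn
  have h1 : 2 * (Nat.log 2 n + c) ^ c ≤ 2 ^ Nat.log 2 n := hL₁ _ hL
  have h2 : 2 ^ Nat.log 2 n ≤ n := Nat.pow_log_le_self 2 hn0
  omega

/-- **Bridge** `TowerRealRootLaw → TowerMatrixDescartes` (the arithmetic of
`Census.matrixDescartes_of_kPlusLogSqLaw`, with the tower hypothesis threaded through). -/
theorem towerMatrixDescartes_of_towerRealRootLaw (h : TowerRealRootLaw) : TowerMatrixDescartes := by
  obtain ⟨C, hC⟩ := h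
  intro c q _hq
  obtain ⟨K₁, hK₁⟩ := StubArith4.exp_le (2 * c) (2 * q * C)
  refine ⟨max K₁ (2 ^ (2 * q * C)), fun K m hK hm d S hT hS => ?_⟩
  have hK1 : K₁ ≤ K := le_of_max_le_left hK
  have hK2 : 2 ^ (2 * q * C) ≤ K := le_of_max_le_right hK
  have hL : 2 * q * C ≤ Nat.log 2 K := Nat.le_log_of_pow_le one_lt_two hK2
  have hlogm : Nat.log 2 m ≤ (Nat.log 2 K + c) ^ c :=
    calc Nat.log 2 m ≤ Nat.log 2 (2 ^ ((Nat.log 2 K + c) ^ c)) := Nat.log_mono_right hm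
      _ = (Nat.log 2 K + c) ^ c := Nat.log_pow one_lt_two _
  have hsq : Nat.log 2 m ^ 2 ≤ (Nat.log 2 K + 2 * c) ^ (2 * c) :=
    calc Nat.log 2 m ^ 2 ≤ ((Nat.log 2 K + c) ^ c) ^ 2 := Nat.pow_le_pow_left hlogm 2
      _ = (Nat.log 2 K + c) ^ (2 * c) := by rw [← pow_mul, mul_comm]
      _ ≤ (Nat.log 2 K + 2 * c) ^ (2 * c) := Nat.pow_le_pow_left (by omega) _
  have hZ := hC m K d S hT hS
  have h1 : 2 * q * C * (Nat.log 2 K + 2 * c) ^ (2 * c) ≤ K * Nat.log 2 K := hK₁ K hK1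
  have h2 : 2 * q * C * K ≤ K * Nat.log 2 K :=
    calc 2 * q * C * K = K * (2 * q * C) := by ring
      _ ≤ K * Nat.log 2 K := Nat.mul_le_mul_left K hL
  have h3 : q * C * Nat.log 2 m ^ 2 ≤ q * C * (Nat.log 2 K + 2 * c) ^ (2 * c) :=
    Nat.mul_le_mul_left _ hsq
  have hexp : q * (C * (K + Nat.log 2 m ^ 2)) ≤ K * Nat.log 2 K := by
    have e1 : q * (C * (K + Nat.log 2 m ^ 2)) = q * C * K + q * C * Nat.log 2 m ^ 2 := by ring
    have e2 : 2 * q * C * (Nat.log 2 K + 2 * c) ^ (2 * c) =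
        2 * (q * C * (Nat.log 2 K + 2 * c) ^ (2 * c)) := by ring
    have e3 : 2 * q * C * K = 2 * (q * C * K) := by ring
    rw [e2] at h1
    rw [e3] at h2
    omega
  calc (Matrix.det (∑ l, ((Polynomial.X : Polynomial ℝ) ^ d l) • (S l).map Polynomial.C)
          ).roots.toFinset.card ^ q
      ≤ (2 ^ (C * (K + Nat.log 2 m ^ 2))) ^ q := Nat.pow_le_pow_left hZ q
    _ = 2 ^ (q * (C * (K + Nat.log 2 m ^ 2))) := by rw [← pow_mul, mul_comm]
    _ ≤ 2 ^ (K * Nat.log 2 K) := Nat.pow_le_pow_right (by norm_num) hexp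

/-- The crux as printed gives its tower restriction (restriction). -/
theorem towerMatrixDescartes_of_matrixDescartes (h : MatrixDescartes) : TowerMatrixDescartes := by
  intro c q hq
  obtain ⟨K₀, hK⟩ := h c q hq
  exact ⟨K₀, fun K m hK0 hm d S _ hS => hK K m hK0 hm d S hS⟩

/-- **The tower door decides the summit**: `TowerMatrixDescartes → PencilTransfer → TowerThetaWitness → VP ≠ VNP`
(the arithmetic of `LacunarySymmetroid.closes`; new step: the transferred support `Fin.cons 0 (2^n)^i` is an
`m`-tower because `m ≤ 2^{(log n + c)^c} < 2^n`, `window_lt` + `isTower_cons_pow`). -/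
theorem closes_tower (hMDR : TowerMatrixDescartes) (hT : PencilTransfer) (hW : TowerThetaWitness) :
    _root_.ValiantsHypothesis := by
  show Literature.Computability.AlgebraicComplexity.VP ℂ ≠ Literature.Computability.AlgebraicComplexity.VNP ℂ
  intro hEq
  obtain ⟨Θ, hVNP, n₀, hroots⟩ := hW
  set d : (n : ℕ) → Fin n → ℕ := fun n i => (2 ^ n) ^ (i : ℕ) with hd
  have hVP : Literature.Computability.AlgebraicComplexity.IsVPFamily
      (fun n => MvPolynomial.map (algebraMap ℝ ℂ) (Θ n)) := by
    have hmem := (Literature.Computability.AlgebraicComplexity.mem_VNP_ofFintype_iff_holds _).2 hVNP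
    rw [← hEq] at hmem
    exact (Literature.Computability.AlgebraicComplexity.mem_VP_ofFintype_iff_holds _).1 hmem
  obtain ⟨c, hc⟩ := hT (fun n => n) Θ hVP d
  obtain ⟨K₀, hK⟩ := hMDR c 4 (by norm_num)
  obtain ⟨n₁, hn₁⟩ := window_lt c
  obtain ⟨n, hn₀, hnK, hn4, hn1⟩ : ∃ n, n₀ ≤ n ∧ K₀ ≤ n ∧ 4 ≤ n ∧ n₁ ≤ n :=
    ⟨n₀ + K₀ + 4 + n₁, by omega, by omega, by omega, by omega⟩
  obtain ⟨m, hm, S, hS, hroot⟩ := hc n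
  set Z := (MvPolynomial.aeval (fun i => (Polynomial.X : Polynomial ℝ) ^ d n i) (Θ n)).roots.toFinset.card
    with hZ
  have hm' : m ≤ 2 ^ ((Nat.log 2 (n + 1) + c) ^ c) :=
    hm.trans (Nat.pow_le_pow_right (by norm_num)
      (Nat.pow_le_pow_left (Nat.add_le_add_right (Nat.log_mono_right (Nat.le_succ n)) c) c))
  -- NEW STEP: the transferred support is an `m`-tower
  have hmG : m < 2 ^ n :=
    lt_of_le_of_lt hm (Nat.pow_lt_pow_right (by norm_num) (hn₁ n hn1))
  have hTow : IsTower m (Fin.cons (α := fun _ => ℕ) (0 : ℕ) (d n)) := isTower_cons_pow hmG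
  have h1 := hK (n + 1) m (by omega) hm' (Fin.cons (α := fun _ => ℕ) (0 : ℕ) (d n)) S hTow hS
  rw [hroot] at h1
  have h2 : 2 ^ (n * Nat.log 2 n) ≤ Z + 1 := hroots n hn₀
  set L := Nat.log 2 n with hL
  have hL2 : 2 ≤ L := by
    rw [hL]
    calc 2 = Nat.log 2 4 := by decide
      _ ≤ Nat.log 2 n := Nat.log_mono_right hn4
  have hLn : L ≤ n := by rw [hL]; exact Nat.log_le_self 2 n
  have hL' : Nat.log 2 (n + 1) ≤ L + 1 := by
    rw [hL]
    calc Nat.log 2 (n + 1) ≤ Nat.log 2 (n * 2) := Nat.log_mono_right (by omega)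
      _ = Nat.log 2 n + 1 := Nat.log_mul_base (by norm_num) (by omega)
  have h3 : Z ^ 4 ≤ 2 ^ ((n + 1) * (L + 1)) :=
    h1.trans (Nat.pow_le_pow_right (by norm_num) (Nat.mul_le_mul_left _ hL'))
  have hnL : 1 ≤ n * L := by nlinarith
  have h4 : 2 ^ (n * L - 1) ≤ Z := by
    have e : 2 ^ (n * L) = 2 * 2 ^ (n * L - 1) := by
      rw [← Nat.pow_succ']
      congr 1
      omega
    have h2' := h2
    rw [e] at h2'
    have : 1 ≤ 2 ^ (n * L - 1) := Nat.one_le_two_pow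
    omega
  have h5 : 2 ^ (4 * (n * L - 1)) ≤ Z ^ 4 := by
    rw [pow_mul']
    exact Nat.pow_le_pow_left h4 4
  have h6 : 4 * (n * L - 1) ≤ (n + 1) * (L + 1) :=
    (Nat.pow_le_pow_iff_right (by norm_num)).1 (h5.trans h3)
  have h7 : 6 * n ≤ 3 * (n * L) := by nlinarith
  have h6' : 4 * (n * L - 1) ≤ n * L + n + L + 1 := by
    have e : (n + 1) * (L + 1) = n * L + n + L + 1 := by ring
    rw [e] at h6
    exact h6
  generalize hP : n * L = P at h6' h7 hnL
  omega

/-- **D2♯ — the sharpest door: ONE explicit support per `K`.**  The crux demanded only on the hyper-geometric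
supports `(0, 1, 2^n, 2^{2n}, …, 2^{n(n-1)})` (`K = n + 1` letters) — literally the only supports `closes_tower`
feeds to the law (stated with the window measured at `n`, as `PencilTransfer` delivers it). -/
def HyperGPMatrixDescartes : Prop :=
  ∀ c q : ℕ, 0 < q → ∃ n₀ : ℕ, ∀ n m : ℕ, n₀ ≤ n → m ≤ 2 ^ ((Nat.log 2 n + c) ^ c) →
    ∀ (S : Fin (n + 1) → Matrix (Fin m) (Fin m) ℝ), (∀ l, (S l).IsSymm) →
      (Matrix.det (∑ l, ((Polynomial.X : Polynomial ℝ) ^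
          (Fin.cons (α := fun _ => ℕ) (0 : ℕ) (fun i : Fin n => (2 ^ n) ^ (i : ℕ)) l)) • (S l).map Polynomial.C)
        ).roots.toFinset.card ^ q ≤ 2 ^ ((n + 1) * Nat.log 2 (n + 1))

/-- `TowerMatrixDescartes → HyperGPMatrixDescartes` (the hyper-GP support is an `m`-tower throughout the window). -/
theorem hyperGP_of_towerMatrixDescartes (h : TowerMatrixDescartes) : HyperGPMatrixDescartes := by
  intro c q hq
  obtain ⟨K₀, hK⟩ := h c q hq
  obtain ⟨n₁, hn₁⟩ := window_lt c
  refine ⟨K₀ + n₁, fun n m hn hm S hS => ?_⟩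
  have hmG : m < 2 ^ n := lt_of_le_of_lt hm (Nat.pow_lt_pow_right (by norm_num) (hn₁ n (by omega)))
  have hm' : m ≤ 2 ^ ((Nat.log 2 (n + 1) + c) ^ c) :=
    hm.trans (Nat.pow_le_pow_right (by norm_num)
      (Nat.pow_le_pow_left (Nat.add_le_add_right (Nat.log_mono_right (Nat.le_succ n)) c) c))
  exact hK (n + 1) m (by omega) hm' _ S (isTower_cons_pow hmG) hS

/-- **The one-support door decides the summit**: `HyperGPMatrixDescartes → PencilTransfer → TowerThetaWitness →
VP ≠ VNP` (same arithmetic as `closes`). -/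
theorem closes_hyperGP (hMDR : HyperGPMatrixDescartes) (hT : PencilTransfer) (hW : TowerThetaWitness) :
    _root_.ValiantsHypothesis := by
  show Literature.Computability.AlgebraicComplexity.VP ℂ ≠ Literature.Computability.AlgebraicComplexity.VNP ℂ
  intro hEq
  obtain ⟨Θ, hVNP, n₀, hroots⟩ := hW
  set d : (n : ℕ) → Fin n → ℕ := fun n i => (2 ^ n) ^ (i : ℕ) with hd
  have hVP : Literature.Computability.AlgebraicComplexity.IsVPFamily
      (fun n => MvPolynomial.map (algebraMap ℝ ℂ) (Θ n)) := by
    have hmem := (Literature.Computability.AlgebraicComplexity.mem_VNP_ofFintype_iff_holds _).2 hVNP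
    rw [← hEq] at hmem
    exact (Literature.Computability.AlgebraicComplexity.mem_VP_ofFintype_iff_holds _).1 hmem
  obtain ⟨c, hc⟩ := hT (fun n => n) Θ hVP d
  obtain ⟨K₀, hK⟩ := hMDR c 4 (by norm_num)
  obtain ⟨n, hn₀, hnK, hn4⟩ : ∃ n, n₀ ≤ n ∧ K₀ ≤ n ∧ 4 ≤ n := ⟨n₀ + K₀ + 4, by omega, by omega, by omega⟩
  obtain ⟨m, hm, S, hS, hroot⟩ := hc n
  set Z := (MvPolynomial.aeval (fun i => (Polynomial.X : Polynomial ℝ) ^ d n i) (Θ n)).roots.toFinset.card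
    with hZ
  have h1 := hK n m hnK hm S hS
  rw [hroot] at h1
  have h2 : 2 ^ (n * Nat.log 2 n) ≤ Z + 1 := hroots n hn₀
  set L := Nat.log 2 n with hL
  have hL2 : 2 ≤ L := by
    rw [hL]
    calc 2 = Nat.log 2 4 := by decide
      _ ≤ Nat.log 2 n := Nat.log_mono_right hn4
  have hLn : L ≤ n := by rw [hL]; exact Nat.log_le_self 2 n
  have hL' : Nat.log 2 (n + 1) ≤ L + 1 := by
    rw [hL]
    calc Nat.log 2 (n + 1) ≤ Nat.log 2 (n * 2) := Nat.log_mono_right (by omega)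
      _ = Nat.log 2 n + 1 := Nat.log_mul_base (by norm_num) (by omega)
  have h3 : Z ^ 4 ≤ 2 ^ ((n + 1) * (L + 1)) :=
    h1.trans (Nat.pow_le_pow_right (by norm_num) (Nat.mul_le_mul_left _ hL'))
  have hnL : 1 ≤ n * L := by nlinarith
  have h4 : 2 ^ (n * L - 1) ≤ Z := by
    have e : 2 ^ (n * L) = 2 * 2 ^ (n * L - 1) := by
      rw [← Nat.pow_succ']
      congr 1
      omega
    have h2' := h2
    rw [e] at h2'
    have : 1 ≤ 2 ^ (n * L - 1) := Nat.one_le_two_pow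
    omega
  have h5 : 2 ^ (4 * (n * L - 1)) ≤ Z ^ 4 := by
    rw [pow_mul']
    exact Nat.pow_le_pow_left h4 4
  have h6 : 4 * (n * L - 1) ≤ (n + 1) * (L + 1) :=
    (Nat.pow_le_pow_iff_right (by norm_num)).1 (h5.trans h3)
  have h7 : 6 * n ≤ 3 * (n * L) := by nlinarith
  have h6' : 4 * (n * L - 1) ≤ n * L + n + L + 1 := by
    have e : (n + 1) * (L + 1) = n * L + n + L + 1 := by ring
    rw [e] at h6
    exact h6
  generalize hP : n * L = P at h6' h7 hnL
  omega

/-- **Corollary (the re-glue)**: `TowerRealRootLaw → PencilTransfer → TowerThetaWitness → VP ≠ VNP`. -/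
theorem valiant_of_towerRealRootLaw (hB : TowerRealRootLaw) (hT : PencilTransfer) (hW : TowerThetaWitness) :
    _root_.ValiantsHypothesis :=
  closes_tower (towerMatrixDescartes_of_towerRealRootLaw hB) hT hW

/-- **LINE (B)'s head feeds the door**: `TowerB → TowerRealRootLaw` (reflection `X ↦ −X` keeps the support, hence
the tower property, and the letters symmetric: `card ≤ ζ₊(F) + ζ₊(F(−X)) + 1 ≤ 2^{(C+2)(K + log² m)}`, tree
`stub_negRoots`). -/
theorem towerRealRootLaw_of_towerB (h : TowerB) : TowerRealRootLaw := by
  obtain ⟨C, hC⟩ := h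
  refine ⟨C + 2, fun m K d S hd hS => ?_⟩
  rcases Nat.eq_zero_or_pos K with hK | hK
  · subst hK
    have h0 : (∑ l : Fin 0, (Polynomial.X : Polynomial ℝ) ^ d l • (S l).map Polynomial.C) = 0 := by simp
    rw [h0]
    rcases Nat.eq_zero_or_pos m with hm | hm
    · subst hm; simp [Matrix.det_isEmpty]
    · haveI : Nonempty (Fin m) := ⟨⟨0, hm⟩⟩
      simp [Matrix.det_zero]
  · have h1 := hC m K d hd S hS
    have h2 := hC m K d hd (fun l => ((-1 : ℝ) ^ d l) • S l) (fun l => (hS l).smul _)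
    have h3 := stub_negRoots K m d S
    set A := C * (K + Nat.log 2 m ^ 2) with hAdef
    have h4 : 2 ^ A + 2 ^ A + 1 ≤ 2 ^ ((C + 2) * (K + Nat.log 2 m ^ 2)) := by
      have h5 : (C + 2) * (K + Nat.log 2 m ^ 2) = A + 2 * (K + Nat.log 2 m ^ 2) := by rw [hAdef]; ring
      have h6 : 2 ≤ 2 * (K + Nat.log 2 m ^ 2) := by omega
      have h7 : 2 ^ 2 ≤ 2 ^ (2 * (K + Nat.log 2 m ^ 2)) := Nat.pow_le_pow_right two_pos h6
      have h8 : 1 ≤ 2 ^ A := Nat.one_le_two_pow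
      calc 2 ^ A + 2 ^ A + 1 ≤ 2 ^ A * 2 ^ 2 := by omega
        _ ≤ 2 ^ A * 2 ^ (2 * (K + Nat.log 2 m ^ 2)) := Nat.mul_le_mul_left _ h7
        _ = 2 ^ ((C + 2) * (K + Nat.log 2 m ^ 2)) := by rw [h5, pow_add]
    exact h3.trans ((Nat.add_le_add (Nat.add_le_add h1 h2) le_rfl).trans h4)

/-- **LINE (B)'s HEAD IS SUMMIT-DECIDING**: `TowerB → PencilTransfer → TowerThetaWitness → VP ≠ VNP`.  With the
tree's PROVED joints this is one application away from the registered stubs: `valiant_of_towerB (towerB_of_graftLaw hGL)`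
(S5, the graft law (GL)) and `valiant_of_towerB towerB_of_sizeDoublingPoly` (S4f + closed S4h) — both checked in this
seat's folder version of the file that imports `tower_graft` directly (`Sketch.lean`, rc 0; attached as item evidence). -/
theorem valiant_of_towerB (hB : TowerB) (hT : PencilTransfer) (hW : TowerThetaWitness) : _root_.ValiantsHypothesis :=
  valiant_of_towerRealRootLaw (towerRealRootLaw_of_towerB hB) hT hW

end Summit.ValiantsHypothesis.ValiantsHypothesis.Cruxes.MatrixDescartes.TowerDoor
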